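import Literature.NumberTheory.EllipticCurves.HeegnerModuleIndex
import Literature.NumberTheory.EllipticCurves.SubgroupSelmerCocycleCriteriaProofs
import HarnessLib

/-!
# No `p`-torsion in the compact Selmer limit `S_p(E/L) = lim←_k Sel_{p^k}(E/L)` when `E(L)[p] = 0`
# (proofs file)

Topic `NumberTheory/EllipticCurves`. THEOREMS ONLY (no definition, no named fact, no `sorry`), on the
vocabulary of `HeegnerModuleIndex.lean` (`torsionH1Over`, `reduceTorsionH1`, `geomTorsionReduce`,
`compactSelmerOver`) and the tree's continuous-cohomology API (`oneCocycleClass`,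
`oneCocycleClass_surjective`, `oneCocycleClass_eq_zero_iff`, `CocycleCriteria.resH1Hom_oneCocycleClass_eq_zero_iff`).
Written by the cell `bsd-print-x9` seat `bsd-line-x9-p2` as the cohomological half of the typing stub
`stub_heegnerModule_zsmul_divisible` of crux stmt-BirchSwinnertonDyer-25235 (line
`torsion-depth-light-ofprint` v3, scaling reduction): "a norm-compatible family all of whose level
components are `p^c`-divisible inside `S_p(E/K_k)` is `p^c`-divisible in `𝔖_p`" needs exactly that
`S_p(E/K_k)` has no `p`-torsion, which holds as soon as `E(K_k)[p] = 0` (Howard 2004 §2.7: "our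
assumption … guarantees that `E(K[n])[p] = 0`"; Perrin-Riou 1987 §0).

WHAT. For a subgroup `H ≤ Γ_K` (`L = K̄^H`) with `E(L)[p] = 0` (`hE`: an `H`-fixed geometric point killed
by `p` is `0`) and a family `x = (x_k) ∈ ∏_k H¹(H, E[p^k])` compatible under the transition maps
`p_* : H¹(H, E[p^{k+1}]) → H¹(H, E[p^k])` (`reduceTorsionH1`; the Selmer conditions are not needed):
* `reduceTorsionH1_eq_zero_of_zsmul_oneCocycleClass_eq_zero`: level `k` from level `k + 1` on a cocycle:
  write `x_{k+1} = [z]`; `[p • z] = 0` gives `Q ∈ E[p^{k+1}]` with `p z(σ) = σQ − Q`; then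
  `p^k Q ∈ E(L)[p] = 0`, so `Q ∈ E[p^k]` and `p_*[z] = [σ ↦ p z(σ)] = [∂Q] = 0`.
* `eq_zero_of_zsmul_eq_zero_of_reduce_eq`: `p • x = 0 ⟹ x = 0`;
  `eq_zero_of_pow_zsmul_eq_zero_of_reduce_eq`: `p^c • x = 0 ⟹ x = 0`;
  `eq_of_pow_zsmul_eq_of_mem_compactSelmerOver`: `p^c • x = p^c • y`, `x, y ∈ S_p(E/L)` ⟹ `x = y`.
HONEST FRAMING: cohomology bookkeeping only; nothing about any particular curve; BSD is not proved by
any of this.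

References: [Howard2004HeegnerKolyvagin] §2.7 ("E(K[n])[p] = 0") and §3.3; [PerrinRiou1987BSMF] §0
pp. 401–402 (`S_p(L)`, transition maps induced by multiplication by `p`); [SerreGaloisCohomology1997]
I §2.2–2.4 (cocycles, functoriality).
-/

set_option autoImplicit false

noncomputable section

open Literature.NumberTheory.GaloisRepresentations Literature.NumberTheory.EllipticCurves

universe u

namespace WeierstrassCurve

variable {K : Type u} [Field K] (W : WeierstrassCurve K) (p : ℕ)
  (H : Subgroup (Field.absoluteGaloisGroup K))

/-- **Level `k` of a compatible family vanishes if level `k+1` is killed by `p`** (`E(L)[p] = 0`), on a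
cocycle: if the class of `p • z` vanishes for `z : H → E[p^{k+1}]`, then `p_*[z] = 0` in `H¹(H, E[p^k])`
— `p z = ∂Q` with `Q ∈ E[p^{k+1}]`, and `p^k Q ∈ E(L)[p] = 0` puts `Q` in `E[p^k]`.
[cite: Howard2004HeegnerKolyvagin, §2.7 (E(K[n])[p] = 0)] [cite: SerreGaloisCohomology1997, I §2.2 (principal crossed homomorphisms)] -/
theorem reduceTorsionH1_eq_zero_of_zsmul_oneCocycleClass_eq_zero
    (hE : ∀ P : geomPoints W, (∀ σ ∈ H, σ • P = P) → (p : ℤ) • P = 0 → P = 0) (k : ℕ)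
    (z : contOneCocycles (discreteTopRep H (geomTorsion W ((p : ℤ) ^ (k + 1)))))
    (hz : oneCocycleClass _ ((p : ℤ) • z) = 0) :
    W.reduceTorsionH1 p k H (oneCocycleClass _ z) = 0 := by
  -- `p z = ∂Q`, `Q ∈ E[p^{k+1}]`
  obtain ⟨Q, hQ⟩ := (oneCocycleClass_eq_zero_iff _ _).mp hz
  have hQ' : ∀ g : H, (p : ℤ) • ((z.1 g : geomTorsion W ((p : ℤ) ^ (k + 1))) : geomPoints W) =
      (g : Field.absoluteGaloisGroup K) • (Q : geomPoints W) - Q := fun g ↦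
    congrArg (fun P : geomTorsion W ((p : ℤ) ^ (k + 1)) ↦ (P : geomPoints W)) (hQ g)
  -- every value of `z` is killed by `p^{k+1}`
  have hzv : ∀ g : H, ((p : ℤ) ^ (k + 1)) • ((z.1 g : geomTorsion W ((p : ℤ) ^ (k + 1))) : geomPoints W) = 0 :=
    fun g ↦ (mem_geomTorsion_iff _ _ _).mp (z.1 g).2
  -- `p^k Q` is `H`-fixed and killed by `p`, hence `0`: so `Q ∈ E[p^k]`
  have hQk : ((p : ℤ) ^ k) • (Q : geomPoints W) = 0 := by
    refine hE _ (fun σ hσ ↦ ?_) ?_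
    · have h1 := hQ' ⟨σ, hσ⟩
      have hσQ : σ • (Q : geomPoints W) = Q + (p : ℤ) • ((z.1 ⟨σ, hσ⟩ : geomTorsion W _) : geomPoints W) := by
        rw [h1]; abel
      rw [smul_zsmul_geomPoints, hσQ, zsmul_add, smul_smul, ← pow_succ, hzv, add_zero]
    · rw [smul_smul, ← pow_succ', (mem_geomTorsion_iff _ _ _).mp Q.2]
  let n : geomTorsion W ((p : ℤ) ^ k) := ⟨Q, (mem_geomTorsion_iff _ _ _).mpr hQk⟩
  -- `p_*[z] = [σ ↦ p z(σ)] = [∂Q] = 0`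
  show resH1Hom (ContinuousMonoidHom.id H) (W.geomTorsionReduce p k) _ (oneCocycleClass _ z) = 0
  rw [CocycleCriteria.resH1Hom_oneCocycleClass_eq_zero_iff]
  exact ⟨n, fun g ↦ Subtype.ext (hQ' g)⟩

/-- **`S_p(E/L)` has no `p`-torsion when `E(L)[p] = 0`** (compatibility alone suffices): a family
`x ∈ ∏_k H¹(H, E[p^k])` with `p_* x_{k+1} = x_k` for all `k` and `p • x = 0` is `0`.
[cite: PerrinRiou1987BSMF, §0 p. 401 (S_p(L) = lim← S(L)^{(p^k)} along multiplication by p)]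
[cite: Howard2004HeegnerKolyvagin, §2.7 (E(K[n])[p] = 0)] -/
theorem eq_zero_of_zsmul_eq_zero_of_reduce_eq
    (hE : ∀ P : geomPoints W, (∀ σ ∈ H, σ • P = P) → (p : ℤ) • P = 0 → P = 0)
    (x : Π k : ℕ, W.torsionH1Over ((p : ℤ) ^ k) H)
    (hx : ∀ k, W.reduceTorsionH1 p k H (x (k + 1)) = x k) (hpx : (p : ℤ) • x = 0) : x = 0 := by
  funext k
  obtain ⟨z, hz⟩ := oneCocycleClass_surjective _ (x (k + 1))
  have hpk : (p : ℤ) • x (k + 1) = 0 := by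
    have := congrFun hpx (k + 1); simpa using this
  have hz0 : oneCocycleClass _ ((p : ℤ) • z) = 0 := by
    rw [oneCocycleClass_smul, hz]
    exact (int_smul_eq_zsmul _ _ _).trans hpk
  rw [Pi.zero_apply, ← hx k, ← hz]
  exact W.reduceTorsionH1_eq_zero_of_zsmul_oneCocycleClass_eq_zero p H hE k z hz0

/-- `p^c • x = 0 ⟹ x = 0` for compatible families, `E(L)[p] = 0` (induction on `c`; `p • x` is again
compatible because the transition maps are additive). [cite: PerrinRiou1987BSMF, §0 p. 401] -/
theorem eq_zero_of_pow_zsmul_eq_zero_of_reduce_eq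
    (hE : ∀ P : geomPoints W, (∀ σ ∈ H, σ • P = P) → (p : ℤ) • P = 0 → P = 0) (c : ℕ)
    (x : Π k : ℕ, W.torsionH1Over ((p : ℤ) ^ k) H)
    (hx : ∀ k, W.reduceTorsionH1 p k H (x (k + 1)) = x k) (hpx : ((p : ℤ) ^ c) • x = 0) : x = 0 := by
  induction c generalizing x with
  | zero => simpa using hpx
  | succ c ih =>
    -- `p^c • (p • x) = 0` and `p • x` is compatible, so `p • x = 0`, so `x = 0`
    have hpx' : ((p : ℤ) ^ c) • ((p : ℤ) • x) = 0 := by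
      rw [← mul_zsmul, ← pow_succ, hpx]
    have hx' : ∀ k, W.reduceTorsionH1 p k H (((p : ℤ) • x) (k + 1)) = ((p : ℤ) • x) k := fun k ↦ by
      rw [Pi.smul_apply, Pi.smul_apply, map_zsmul, hx k]
    exact W.eq_zero_of_zsmul_eq_zero_of_reduce_eq p H hE x hx (ih ((p : ℤ) • x) hx' hpx')

/-- **Division by `p^c` is unique in `S_p(E/L)`** (`E(L)[p] = 0`): two elements of the compact Selmer
group with the same `p^c`-multiple are equal. [cite: PerrinRiou1987BSMF, §0 p. 401 (S_p(L))]
[cite: Howard2004HeegnerKolyvagin, §2.7 (E(K[n])[p] = 0)] -/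
theorem eq_of_pow_zsmul_eq_of_mem_compactSelmerOver [NumberField K] [H.Normal]
    (hE : ∀ P : geomPoints W, (∀ σ ∈ H, σ • P = P) → (p : ℤ) • P = 0 → P = 0) (c : ℕ)
    {x y : Π k : ℕ, W.torsionH1Over ((p : ℤ) ^ k) H}
    (hx : x ∈ W.compactSelmerOver H p) (hy : y ∈ W.compactSelmerOver H p)
    (h : ((p : ℤ) ^ c) • x = ((p : ℤ) ^ c) • y) : x = y := by
  rw [mem_compactSelmerOver_iff] at hx hy
  have hxy : ∀ k, W.reduceTorsionH1 p k H ((x - y) (k + 1)) = (x - y) k := fun k ↦ by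
    rw [Pi.sub_apply, Pi.sub_apply, map_sub, hx.2 k, hy.2 k]
  have h0 : ((p : ℤ) ^ c) • (x - y) = 0 := by rw [zsmul_sub, h, sub_self]
  exact sub_eq_zero.mp (W.eq_zero_of_pow_zsmul_eq_zero_of_reduce_eq p H hE c (x - y) hxy h0)

end WeierstrassCurve

end
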